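import Summits.SmoothPoincare4.SmoothPoincare4.Theorems.DottedCircleRasmussenDcrGapHelperHandlebodyChartModelHandlesCollarPhase

/-!
# Helper `helper_handlebodyChart_modelHandles` (M3: handle structure of the model dotted handlebody `D_k`)
# of line `mk_friends` for crux `DcrGap` — phase data, part 1: the ball branch of the argument
(item stmt-SmoothPoincare4-16128, route route-SmoothPoincare4-DottedCircleRasmussen)

**Registered piece `helper_handlebodyChart_modelHandles_ballBranch` of the model lemma M3.**  The phase clause
of the data stub `helper_handlebodyChart_modelHandles_data` is assembled (sibling file `…ModelHandlesPhase.lean`)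
from lifts of the angles `arg(z - c_l)` about the hole centres along the handle tubes and from a fixed smooth
branch of these angles near the base ball `B̄(c, 3a/2)`: the **ball branch**
`β(z) = arg((z - e) \overline{(z_c - e)}) + arg(z_c - e)` of `arg(z - e)` centred at the direction of `z_c - e`
(`z_c = z(c)`, `e` a hole centre).  This file proves its two properties: `e^{iβ(z)} = u(z - e)`
(`u(v) = v/|v|`, `ModelHandles.unit_eq_exp_ballBranch`) and real-smoothness at the points `z` with
`|z - z_c| < |z_c - e|`, where `(z - e)\overline{(z_c - e)}` has positive real part
(`ModelHandles.contDiffAt_ballBranch`); and the compactness lemma `ModelHandles.exists_box_subset` (an open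
rotation-invariant box between the closed model tube `T` and any open `W ⊇ T`).

No definitions, no named facts, no `sorry`.  References: R. Kirby, *The Topology of 4-Manifolds*,
LNM 1374 (1989), Ch. I §2 [Kirby1989].
-/

-- the prescribed namespace `Summit.<P>.<Sub>.…` duplicates `SmoothPoincare4` (P = Sub)
set_option linter.dupNamespace false
set_option linter.style.longLine false
noncomputable section

open scoped Manifold ContDiff Topology
open Function Set Metric Filter
open Literature.Topology.FourManifolds Literature.Topology.FourManifolds.MMSW
open Literature.AlgebraicTopology.Homotopy.HopfFibration

namespace Summit.SmoothPoincare4.SmoothPoincare4.Theorems.DcrGap.MkFriends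

namespace ModelHandles

/-! ## A rotation-invariant box between `T` and `W` -/

/-- **An open box between the closed tube `T` and an open `W ⊇ T`**: some box
`{|p₀| < 1 + η, p₁² + p₂² + p₃² < 1 + η}` (`η > 0`) lies in `W` (the closed boxes decrease to the compact
`T`). [folklore] -/
theorem exists_box_subset {W : Set (EuclideanSpace ℝ (Fin 4))} (hWo : IsOpen W)
    (hTW : {p : EuclideanSpace ℝ (Fin 4) | |p 0| ≤ 1 ∧ (p 1) ^ 2 + (p 2) ^ 2 + (p 3) ^ 2 ≤ 1} ⊆ W) :
    ∃ η : ℝ, 0 < η ∧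
      {p : EuclideanSpace ℝ (Fin 4) | |p 0| < 1 + η ∧ (p 1) ^ 2 + (p 2) ^ 2 + (p 3) ^ 2 < 1 + η} ⊆ W := by
  set Z : ℕ → Set (EuclideanSpace ℝ (Fin 4)) := fun n =>
    {p | |p 0| ≤ 1 + 1 / ((n : ℝ) + 1) ∧ (p 1) ^ 2 + (p 2) ^ 2 + (p 3) ^ 2 ≤ 1 + 1 / ((n : ℝ) + 1)} with hZ
  have hZc : ∀ n, IsClosed (Z n) := fun n => by
    simp only [hZ, Set.setOf_and]
    exact (isClosed_le (by fun_prop : Continuous fun p : EuclideanSpace ℝ (Fin 4) => |p 0|)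
      continuous_const).inter (isClosed_le (by fun_prop : Continuous fun p : EuclideanSpace ℝ (Fin 4) =>
        (p 1) ^ 2 + (p 2) ^ 2 + (p 3) ^ 2) continuous_const)
  have hanti : ∀ i j : ℕ, i ≤ j → Z j ⊆ Z i := by
    intro i j hij p hp
    have h1 : (1 : ℝ) / ((j : ℝ) + 1) ≤ 1 / ((i : ℝ) + 1) := by
      apply one_div_le_one_div_of_le (by positivity)
      have : (i : ℝ) ≤ j := by exact_mod_cast hij
      linarith
    exact ⟨hp.1.trans (by linarith), hp.2.trans (by linarith)⟩
  have hZ0c : IsCompact (Z 0) := by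
    refine Metric.isCompact_of_isClosed_isBounded (hZc 0) ?_
    refine (isBounded_closedBall (x := (0 : EuclideanSpace ℝ (Fin 4))) (r := 3)).subset
      fun p hp => mem_closedBall_zero_iff.2 ?_
    have h0 : |p 0| ≤ 2 := by have := hp.1; norm_num at this; linarith
    have h1 : (p 1) ^ 2 + (p 2) ^ 2 + (p 3) ^ 2 ≤ 3 := by have := hp.2; norm_num at this; linarith
    have hsq : ‖p‖ ^ 2 = (p 0) ^ 2 + (p 1) ^ 2 + (p 2) ^ 2 + (p 3) ^ 2 := by
      rw [EuclideanSpace.norm_eq, Real.sq_sqrt (Finset.sum_nonneg fun i _ => by positivity),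
        Fin.sum_univ_four]
      simp [sq_abs]
    have hp0 : (p 0) ^ 2 ≤ 4 := by nlinarith [abs_nonneg (p 0), sq_abs (p 0)]
    nlinarith [norm_nonneg p]
  have hst : (Z 0 \ W) ∩ ⋂ n, Z n = ∅ := by
    refine eq_empty_iff_forall_notMem.2 fun p hp => hp.1.2 (hTW ?_)
    have hall : ∀ n, p ∈ Z n := fun n => mem_iInter.1 hp.2 n
    have hsmall : ∀ t : ℝ, (∀ n : ℕ, t ≤ 1 + 1 / ((n : ℝ) + 1)) → t ≤ 1 := by
      intro t ht
      refine le_of_forall_pos_lt_add fun ε hε => ?_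
      obtain ⟨n, hn⟩ := exists_nat_one_div_lt hε
      linarith [ht n]
    exact ⟨hsmall _ fun n => (hall n).1, hsmall _ fun n => (hall n).2⟩
  have hdir : Directed (· ⊇ ·) Z := directed_of_isDirected_le fun i j hij => hanti i j hij
  obtain ⟨n, hn⟩ := (hZ0c.diff hWo).elim_directed_family_closed Z hZc hst hdir
  refine ⟨1 / ((n : ℝ) + 1), by positivity, fun p hp => ?_⟩
  have hpZ : p ∈ Z n := ⟨hp.1.le, hp.2.le⟩
  by_contra hpW
  have : p ∈ (Z 0 \ W) ∩ Z n := ⟨⟨hanti 0 n (Nat.zero_le n) hpZ, hpW⟩, hpZ⟩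
  rw [hn] at this
  exact this

/-! ## The ball branch of the argument about a hole -/

/-- `u(w) = e^{i(arg(w d̄) + arg d)}` for `w, d ≠ 0`: the branch of `arg w` centred at the direction of
`d`. [folklore] -/
theorem unit_eq_exp_ballBranch {w d : ℂ} (hw : w ≠ 0) (hd : d ≠ 0) :
    w / ((‖w‖ : ℝ) : ℂ) =
      Complex.exp (((Complex.arg (w * (starRingEnd ℂ) d) + Complex.arg d : ℝ) : ℂ) * Complex.I) := by
  have hd' : (starRingEnd ℂ) d ≠ 0 := (map_ne_zero _).2 hd
  push_cast
  rw [add_mul, Complex.exp_add, ← unit_eq_exp_arg (mul_ne_zero hw hd'), ← unit_eq_exp_arg hd]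
  have hn0 : ((‖w‖ : ℝ) : ℂ) ≠ 0 := by exact_mod_cast norm_ne_zero_iff.2 hw
  have hnd : ((‖d‖ : ℝ) : ℂ) ≠ 0 := by exact_mod_cast norm_ne_zero_iff.2 hd
  have hcd : (starRingEnd ℂ) d * d = ((‖d‖ : ℝ) : ℂ) ^ 2 := Complex.conj_mul' d
  rw [norm_mul, Complex.norm_conj, Complex.ofReal_mul, div_mul_div_comm, mul_assoc w, hcd]
  field_simp

/-- The ball branch `arg((z - e) d̄) + arg d` (`d = z_c - e`) is real-smooth at the points `z` with
`|z - z_c| < |d|` (there `(z - e) d̄` has positive real part). [folklore] -/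
theorem contDiffAt_ballBranch {z zc e : ℂ} (h : ‖z - zc‖ < ‖zc - e‖) :
    ContDiffAt ℝ ∞ (fun z => Complex.arg ((z - e) * (starRingEnd ℂ) (zc - e)) + Complex.arg (zc - e)) z := by
  refine ContDiffAt.add ?_ contDiffAt_const
  have hre : 0 < ((z - e) * (starRingEnd ℂ) (zc - e)).re := by
    have h1 : (z - e) * (starRingEnd ℂ) (zc - e) =
        (z - zc) * (starRingEnd ℂ) (zc - e) + (((‖zc - e‖ : ℝ) : ℂ)) ^ 2 := by
      rw [← Complex.conj_mul' (zc - e)]; ring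
    rw [h1, Complex.add_re]
    have h2 : |((z - zc) * (starRingEnd ℂ) (zc - e)).re| ≤ ‖z - zc‖ * ‖zc - e‖ := by
      calc |((z - zc) * (starRingEnd ℂ) (zc - e)).re| ≤ ‖(z - zc) * (starRingEnd ℂ) (zc - e)‖ :=
            Complex.abs_re_le_norm _
        _ = ‖z - zc‖ * ‖zc - e‖ := by rw [norm_mul, Complex.norm_conj]
    have h3 : ((((‖zc - e‖ : ℝ) : ℂ)) ^ 2).re = ‖zc - e‖ ^ 2 := by
      rw [← Complex.ofReal_pow, Complex.ofReal_re]
    rw [h3]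
    have hpos : 0 < ‖zc - e‖ := lt_of_le_of_lt (norm_nonneg _) h
    nlinarith [neg_abs_le ((z - zc) * (starRingEnd ℂ) (zc - e)).re, mul_lt_mul_of_pos_right h hpos]
  exact (contDiffAt_arg (Or.inl hre)).comp z ((contDiffAt_id.sub contDiffAt_const).mul contDiffAt_const)

end ModelHandles

/-- **Registered piece `helper_handlebodyChart_modelHandles_ballBranch` of the model lemma M3 (the ball branch
of the argument about a hole)**: `u(w) = e^{i(arg(w d̄) + arg d)}` for `w, d ≠ 0`, and
`z ↦ arg((z - e)\overline{(z_c - e)}) + arg(z_c - e)` is real-smooth wherever `|z - z_c| < |z_c - e|`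
(`ModelHandles.unit_eq_exp_ballBranch`, `ModelHandles.contDiffAt_ballBranch`). [folklore] -/
theorem helper_handlebodyChart_modelHandles_ballBranch : (∀ (w d : ℂ), w ≠ 0 → d ≠ 0 → w / ((‖w‖ : ℝ) : ℂ) = Complex.exp (((Complex.arg (w * (starRingEnd ℂ) d) + Complex.arg d : ℝ) : ℂ) * Complex.I)) ∧ ∀ (z zc e : ℂ), ‖z - zc‖ < ‖zc - e‖ → ContDiffAt ℝ ((⊤ : ℕ∞) : WithTop ℕ∞) (fun z => Complex.arg ((z - e) * (starRingEnd ℂ) (zc - e)) + Complex.arg (zc - e)) z :=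
  ⟨fun _ _ hw hd => ModelHandles.unit_eq_exp_ballBranch hw hd, fun _ _ _ h => ModelHandles.contDiffAt_ballBranch h⟩

end Summit.SmoothPoincare4.SmoothPoincare4.Theorems.DcrGap.MkFriends

end
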